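import Summits.AtomisticToContinuum.Crystallization.Theorems.OverbindingBudgetAffineTaylorCellHcpVecsC

/-!
# OverbindingBudget — Taylor-model cells for the far-window certificate, part 12/16 «IntKernel»

MODULE PLAN (lens-4 g68, at hand-2's landing-shape request of 2026-09-02T14:19Z, critic row 1199 (II)) of the VERIFIED g67 leaf
`OverbindingBudgetAffineTaylorCell.lean` (sha256 `dabedef39e0c5fd2…`, 4214 l, critic row 1196): this module = leaf l.2985–3288, l.3302–3302
(§8 tail (Acc.q0 …), §9 integer kernel (fixed-point twin), kernel evaluation order), body VERBATIM except as listed in `MAP.md` — here: section Probe (l.3289-3301) removed.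
Same namespace `…Theorems.OverbindingBudgetAffineTaylorCell` in all 16 parts (declaration names unchanged); the parts import each other
linearly.  No `sorry`, no `native_decide`, standard axioms; no instances/notation; scoped `set_option maxHeartbeats` with explicit bounds only.
-/

namespace Summit.AtomisticToContinuum.Crystallization.Theorems.OverbindingBudgetAffineTaylorCell

/-- The probe quantities read off an accumulator: constant coefficient `q₀`, remainder, `U_max`, flag. -/
def Acc.q0 (A : Acc) : ℚ := A.coef.headD 0

/-! ## §9 Integer kernel: the fixed-point twin of the coefficient accumulation

The cell centre is given by integer Gram numerators over a common denominator `E` (`G = g/E`). Then `c = K/(9E)` with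
`K = Nᵀ g N ∈ ℤ`, `ℓ_i = L_i/9` with `L_i ∈ ℤ[N]`, and the rounded slot contribution of the `ℚ` kernel is ONE Euclidean
division: `⌊D · termQ⌋ = numZ / K^{m+d}` (`CellZ.rcZ_cast`). The accumulated table is a `List ℤ` (units `1/D`) and
`CellZ.coefZ_cast` identifies it with the `ℚ` kernel's table EXACTLY, so §4–§8 apply unchanged; only the per-chunk
materialisation jobs change (integer arithmetic is kernel-accelerated and carries no normalisation proofs). -/

/-- Integer symmetric matrix with zero `(0,0)` entry. -/
structure ZF0 where
  a01 : ℤ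
  a02 : ℤ
  a11 : ℤ
  a12 : ℤ
  a22 : ℤ
deriving DecidableEq

/-- `ZF0.form` (docstring added by the landing lane; see the module docstring). [formal bookkeeping] -/
def ZF0.form (M : ZF0) (x y z : ℤ) : ℤ :=
  2 * M.a01 * x * y + 2 * M.a02 * x * z + M.a11 * y * y + 2 * M.a12 * y * z + M.a22 * z * z

/-- `ZF0.toQ` (docstring added by the landing lane; see the module docstring). [formal bookkeeping] -/
def ZF0.toQ (M : ZF0) : QF0 := ⟨M.a01, M.a02, M.a11, M.a12, M.a22⟩

/-- Integer direction matrices (a gradient-aligned cell uses an INTEGER matrix `R`, `t = R s`; column `j` of `R` placed on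
`(a₀₁, a₀₂, a₁₁, a₁₂, a₂₂)` is `M_j`). -/
structure DirZ5 where
  m1 : ZF0
  m2 : ZF0
  m3 : ZF0
  m4 : ZF0
  m5 : ZF0
deriving DecidableEq

/-- `DirZ5.toDir` (docstring added by the landing lane; see the module docstring). [formal bookkeeping] -/
def DirZ5.toDir (M : DirZ5) : Dir5 := ⟨M.m1.toQ, M.m2.toQ, M.m3.toQ, M.m4.toQ, M.m5.toQ⟩

/-- Axis-aligned integer directions `(E₀₁, E₀₂, E₁₁, E₁₂, E₂₂)`. -/
def DirZ5.std : DirZ5 :=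
  { m1 := ⟨1, 0, 0, 0, 0⟩, m2 := ⟨0, 1, 0, 0, 0⟩, m3 := ⟨0, 0, 1, 0, 0⟩, m4 := ⟨0, 0, 0, 1, 0⟩, m5 := ⟨0, 0, 0, 0, 1⟩ }

/-- `ZF0.toQ_form` (docstring added by the landing lane; see the module docstring). [formal bookkeeping] -/
theorem ZF0.toQ_form (M : ZF0) (x y z : ℤ) : M.toQ.form x y z = (M.form x y z : ℚ) := by
  simp only [QF0.form, ZF0.toQ, ZF0.form]
  push_cast
  ring

/-- `CellZ` (docstring added by the landing lane; see the module docstring). [formal bookkeeping] -/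
structure CellZ where
  m : ℕ
  J : ℕ
  g00 : ℤ
  g01 : ℤ
  g02 : ℤ
  g11 : ℤ
  g12 : ℤ
  g22 : ℤ
  E : ℕ
  h1 : ℚ
  h2 : ℚ
  h3 : ℚ
  h4 : ℚ
  h5 : ℚ
  D : ℕ
  /-- integer direction matrices (K6); default = axis-aligned -/
  dirz : DirZ5 := DirZ5.std

/-- The `ℚ` cell with the same centre, directions, widths and denominator. -/
def CellZ.toCell (Z : CellZ) : Cell :=
  { m := Z.m, J := Z.J,
    Gc := { a00 := Z.g00 / Z.E, a01 := Z.g01 / Z.E, a02 := Z.g02 / Z.E, a11 := Z.g11 / Z.E, a12 := Z.g12 / Z.E,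
            a22 := Z.g22 / Z.E },
    h1 := Z.h1, h2 := Z.h2, h3 := Z.h3, h4 := Z.h4, h5 := Z.h5, D := Z.D, dir := Z.dirz.toDir }

/-- `CellZ.withM` (docstring added by the landing lane; see the module docstring). [formal bookkeeping] -/
def CellZ.withM (Z : CellZ) (k : ℕ) : CellZ := { Z with m := k }

/-- `CellZ.toCell_withM` (docstring added by the landing lane; see the module docstring). [formal bookkeeping] -/
theorem CellZ.toCell_withM (Z : CellZ) (k : ℕ) : (Z.withM k).toCell = Z.toCell.withM k := rfl
/-- `CellZ.toCell_m` (docstring added by the landing lane; see the module docstring). [formal bookkeeping] -/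
@[simp] theorem CellZ.toCell_m (Z : CellZ) : Z.toCell.m = Z.m := rfl
/-- `CellZ.toCell_J` (docstring added by the landing lane; see the module docstring). [formal bookkeeping] -/
@[simp] theorem CellZ.toCell_J (Z : CellZ) : Z.toCell.J = Z.J := rfl
/-- `CellZ.toCell_D` (docstring added by the landing lane; see the module docstring). [formal bookkeeping] -/
@[simp] theorem CellZ.toCell_D (Z : CellZ) : Z.toCell.D = Z.D := rfl

/-- `K = Nᵀ g N = 9E · c`. -/
def CellZ.K (Z : CellZ) (x y z : ℤ) : ℤ :=
  Z.g00 * x * x + 2 * Z.g01 * x * y + 2 * Z.g02 * x * z + Z.g11 * y * y + 2 * Z.g12 * y * z + Z.g22 * z * z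

/-- Signed Taylor coefficient `a_j(m) = (−1)^j · C(m+j−1, j)` as an integer. -/
def tcoefZ (m j : ℕ) : ℤ := (-1 : ℤ) ^ j * (Nat.choose (m + j - 1) j : ℤ)

/-- Numerator of `D · termQ`: `D · a_d(m) · mult · 9^m · E^{m+d} · Π L_i^{e_i}` with `L_i = Nᵀ M_i N = 9ℓ_i ∈ ℤ`. -/
def CellZ.numZ (Z : CellZ) (x y z : ℤ) (mo : Mono) : ℤ :=
  Z.D * tcoefZ Z.m mo.d * mo.mult * 9 ^ Z.m * (Z.E : ℤ) ^ (Z.m + mo.d) *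
    (Z.dirz.m1.form x y z ^ mo.e1 * Z.dirz.m2.form x y z ^ mo.e2 * Z.dirz.m3.form x y z ^ mo.e3 *
      Z.dirz.m4.form x y z ^ mo.e4 * Z.dirz.m5.form x y z ^ mo.e5)

/-- Integer slot contribution `⌊D · termQ⌋` = ONE Euclidean division by `K^{m+d} > 0`; `0` if inadmissible or `d ≥ J`. -/
def CellZ.rcZ (Z : CellZ) (N : ℤ × ℤ × ℤ) (mo : Mono) : ℤ :=
  if Z.K N.1 N.2.1 N.2.2 ≤ 0 then 0
  else if mo.d < Z.J then Z.numZ N.1 N.2.1 N.2.2 mo / Z.K N.1 N.2.1 N.2.2 ^ (Z.m + mo.d) else 0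

/-! #### Kernel evaluation order
`decide +kernel` reduces call-by-name: a `let`/argument used `k` times is recomputed `k` times.  `forceZ a k` makes the kernel
evaluate the integer `a` to a literal FIRST (iota-reduction on the `Int` constructors needs the weak-head normal form of `a`) and
hands the literal to the continuation, so the per-vector quantities `K, L₁…L₅` are computed once per vector instead of once per slot
use (≈ 10³ times).  `stepZ_eq` shows the fast step IS the specification `a + rcZ N mo` slot-wise. -/

/-- Evaluate `a` to an integer literal, then continue. -/
def forceZ {α : Type} (a : ℤ) (k : ℤ → α) : α :=
  match a with
  | Int.ofNat n => k (Int.ofNat n)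
  | Int.negSucc n => k (Int.negSucc n)

/-- `forceZ_eq` (docstring added by the landing lane; see the module docstring). [formal bookkeeping] -/
theorem forceZ_eq {α : Type} (a : ℤ) (k : ℤ → α) : forceZ a k = k a := by
  cases a <;> rfl

/-- `numZ` / `rcZ` on precomputed per-vector data `K, L₁…L₅`. -/
def CellZ.numZL (Z : CellZ) (L1 L2 L3 L4 L5 : ℤ) (mo : Mono) : ℤ :=
  Z.D * tcoefZ Z.m mo.d * mo.mult * 9 ^ Z.m * (Z.E : ℤ) ^ (Z.m + mo.d) *
    (L1 ^ mo.e1 * L2 ^ mo.e2 * L3 ^ mo.e3 * L4 ^ mo.e4 * L5 ^ mo.e5)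
/-- `CellZ.rcZL` (docstring added by the landing lane; see the module docstring). [formal bookkeeping] -/
def CellZ.rcZL (Z : CellZ) (K L1 L2 L3 L4 L5 : ℤ) (mo : Mono) : ℤ :=
  if K ≤ 0 then 0 else if mo.d < Z.J then Z.numZL L1 L2 L3 L4 L5 mo / K ^ (Z.m + mo.d) else 0

/-- `CellZ.rcZL_eq` (docstring added by the landing lane; see the module docstring). [formal bookkeeping] -/
theorem CellZ.rcZL_eq (Z : CellZ) (N : ℤ × ℤ × ℤ) (mo : Mono) :
    Z.rcZL (Z.K N.1 N.2.1 N.2.2) (Z.dirz.m1.form N.1 N.2.1 N.2.2) (Z.dirz.m2.form N.1 N.2.1 N.2.2)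
      (Z.dirz.m3.form N.1 N.2.1 N.2.2) (Z.dirz.m4.form N.1 N.2.1 N.2.2) (Z.dirz.m5.form N.1 N.2.1 N.2.2) mo = Z.rcZ N mo := rfl

/-- The accumulator step (fast evaluation order; `= a + rcZ N mo` slot-wise by `stepZ_eq`). -/
def CellZ.stepZ (Z : CellZ) (acc : List ℤ) (N : ℤ × ℤ × ℤ) : List ℤ :=
  forceZ (Z.K N.1 N.2.1 N.2.2) fun K =>
  forceZ (Z.dirz.m1.form N.1 N.2.1 N.2.2) fun L1 =>
  forceZ (Z.dirz.m2.form N.1 N.2.1 N.2.2) fun L2 =>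
  forceZ (Z.dirz.m3.form N.1 N.2.1 N.2.2) fun L3 =>
  forceZ (Z.dirz.m4.form N.1 N.2.1 N.2.2) fun L4 =>
  forceZ (Z.dirz.m5.form N.1 N.2.1 N.2.2) fun L5 =>
    List.zipWith (fun a mo => a + Z.rcZL K L1 L2 L3 L4 L5 mo) acc monos

/-- `CellZ.stepZ_eq` (docstring added by the landing lane; see the module docstring). [formal bookkeeping] -/
theorem CellZ.stepZ_eq (Z : CellZ) (acc : List ℤ) (N : ℤ × ℤ × ℤ) :
    Z.stepZ acc N = List.zipWith (fun a mo => a + Z.rcZ N mo) acc monos := by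
  simp only [CellZ.stepZ, forceZ_eq, CellZ.rcZL_eq]

/-- The integer coefficient table of a family (units `1/D`), one pass. -/
def CellZ.coefZ (Z : CellZ) (vs : List (ℤ × ℤ × ℤ)) : List ℤ := vs.foldl Z.stepZ (monos.map fun _ => 0)

/-- `CellZ.foldl_coefZ` (docstring added by the landing lane; see the module docstring). [formal bookkeeping] -/
theorem CellZ.foldl_coefZ (Z : CellZ) (vs : List (ℤ × ℤ × ℤ)) :
    ∀ (A : List ℤ) (f : Mono → ℤ), A = monos.map f →
      vs.foldl Z.stepZ A = monos.map fun mo => f mo + (vs.map fun N => Z.rcZ N mo).sum := by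
  induction vs with
  | nil =>
    intro A f hA
    simpa using hA
  | cons N vs ih =>
    intro A f hA
    rw [List.foldl_cons]
    have hstep : Z.stepZ A N = monos.map fun mo => f mo + Z.rcZ N mo := by
      rw [Z.stepZ_eq, hA, zipWith_map_self]
    rw [ih _ _ hstep]
    congr 1
    funext mo
    simp [add_assoc]

/-- CLOSED FORM of the integer table. -/
theorem CellZ.coefZ_eq (Z : CellZ) (vs : List (ℤ × ℤ × ℤ)) :
    Z.coefZ vs = monos.map fun mo => (vs.map fun N => Z.rcZ N mo).sum := by
  unfold CellZ.coefZ
  rw [Z.foldl_coefZ vs _ (fun _ => 0) rfl]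
  simp

/-- Table fact: every slot's exponents sum to its degree. -/
theorem monos_d_sum : ∀ mo ∈ monos, mo.e1 + mo.e2 + mo.e3 + mo.e4 + mo.e5 = mo.d := by decide +kernel

/-- `CellZ.toCell_cOf` (docstring added by the landing lane; see the module docstring). [formal bookkeeping] -/
theorem CellZ.toCell_cOf (Z : CellZ) (hE : 0 < Z.E) (x y z : ℤ) :
    Z.toCell.cOf x y z = (Z.K x y z : ℚ) / (9 * Z.E) := by
  have hE' : (Z.E : ℚ) ≠ 0 := by exact_mod_cast hE.ne'
  simp only [Cell.cOf, CellZ.toCell, SymQ.form, CellZ.K]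
  push_cast
  field_simp

/-- `CellZ.toCell_l1Of` (docstring added by the landing lane; see the module docstring). [formal bookkeeping] -/
theorem CellZ.toCell_l1Of (Z : CellZ) (x y z : ℤ) :
    Z.toCell.l1Of x y z = (Z.dirz.m1.form x y z : ℚ) / 9 := by
  simp only [Cell.l1Of, CellZ.toCell, DirZ5.toDir, ZF0.toQ_form]
/-- `CellZ.toCell_l2Of` (docstring added by the landing lane; see the module docstring). [formal bookkeeping] -/
theorem CellZ.toCell_l2Of (Z : CellZ) (x y z : ℤ) :
    Z.toCell.l2Of x y z = (Z.dirz.m2.form x y z : ℚ) / 9 := by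
  simp only [Cell.l2Of, CellZ.toCell, DirZ5.toDir, ZF0.toQ_form]
/-- `CellZ.toCell_l3Of` (docstring added by the landing lane; see the module docstring). [formal bookkeeping] -/
theorem CellZ.toCell_l3Of (Z : CellZ) (x y z : ℤ) :
    Z.toCell.l3Of x y z = (Z.dirz.m3.form x y z : ℚ) / 9 := by
  simp only [Cell.l3Of, CellZ.toCell, DirZ5.toDir, ZF0.toQ_form]
/-- `CellZ.toCell_l4Of` (docstring added by the landing lane; see the module docstring). [formal bookkeeping] -/
theorem CellZ.toCell_l4Of (Z : CellZ) (x y z : ℤ) :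
    Z.toCell.l4Of x y z = (Z.dirz.m4.form x y z : ℚ) / 9 := by
  simp only [Cell.l4Of, CellZ.toCell, DirZ5.toDir, ZF0.toQ_form]
/-- `CellZ.toCell_l5Of` (docstring added by the landing lane; see the module docstring). [formal bookkeeping] -/
theorem CellZ.toCell_l5Of (Z : CellZ) (x y z : ℤ) :
    Z.toCell.l5Of x y z = (Z.dirz.m5.form x y z : ℚ) / 9 := by
  simp only [Cell.l5Of, CellZ.toCell, DirZ5.toDir, ZF0.toQ_form]

/-- The exact bridge `D · termQ = numZ / K^{m+d}` (uses `Σ e_i = d`). -/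
theorem CellZ.termQ_mul_D (Z : CellZ) (hE : 0 < Z.E) (x y z : ℤ) (mo : Mono)
    (hmo : mo.e1 + mo.e2 + mo.e3 + mo.e4 + mo.e5 = mo.d) (hK : 0 < Z.K x y z) :
    Z.toCell.termQ x y z mo * Z.D = (Z.numZ x y z mo : ℚ) / ((Z.K x y z ^ (Z.m + mo.d) : ℤ) : ℚ) := by
  have hc := Z.toCell_cOf hE x y z
  have hK' : (Z.K x y z : ℚ) ≠ 0 := by exact_mod_cast hK.ne'
  have hE' : (Z.E : ℚ) ≠ 0 := by exact_mod_cast hE.ne'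
  have h9 : (9 : ℚ) ^ (Z.m + mo.d) = 9 ^ Z.m * (9 ^ mo.e1 * 9 ^ mo.e2 * 9 ^ mo.e3 * 9 ^ mo.e4 * 9 ^ mo.e5) := by
    rw [← hmo]; ring
  simp only [Cell.termQ, CellZ.numZ, tcoef, tcoefZ, Z.toCell_l1Of, Z.toCell_l2Of, Z.toCell_l3Of, Z.toCell_l4Of,
    Z.toCell_l5Of, hc, CellZ.toCell_m]
  rw [one_div_div, div_pow, mul_pow, h9]
  simp only [div_pow]
  push_cast
  have h1 : (9 : ℚ) ^ mo.e1 ≠ 0 := pow_ne_zero _ (by norm_num)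
  have h2 : (9 : ℚ) ^ mo.e2 ≠ 0 := pow_ne_zero _ (by norm_num)
  have h3 : (9 : ℚ) ^ mo.e3 ≠ 0 := pow_ne_zero _ (by norm_num)
  have h4 : (9 : ℚ) ^ mo.e4 ≠ 0 := pow_ne_zero _ (by norm_num)
  have h5 : (9 : ℚ) ^ mo.e5 ≠ 0 := pow_ne_zero _ (by norm_num)
  have hP : (Z.K x y z : ℚ) ^ (Z.m + mo.d) ≠ 0 := pow_ne_zero _ hK'
  generalize (9 : ℚ) ^ mo.e1 = n1 at h1 ⊢
  generalize (9 : ℚ) ^ mo.e2 = n2 at h2 ⊢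
  generalize (9 : ℚ) ^ mo.e3 = n3 at h3 ⊢
  generalize (9 : ℚ) ^ mo.e4 = n4 at h4 ⊢
  generalize (9 : ℚ) ^ mo.e5 = n5 at h5 ⊢
  generalize (Z.K x y z : ℚ) ^ (Z.m + mo.d) = P at hP ⊢
  generalize (9 : ℚ) ^ Z.m = A
  generalize (Z.E : ℚ) ^ (Z.m + mo.d) = Q
  generalize (Z.dirz.m1.form x y z : ℚ) ^ mo.e1 = u1
  generalize (Z.dirz.m2.form x y z : ℚ) ^ mo.e2 = u2
  generalize (Z.dirz.m3.form x y z : ℚ) ^ mo.e3 = u3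
  generalize (Z.dirz.m4.form x y z : ℚ) ^ mo.e4 = u4
  generalize (Z.dirz.m5.form x y z : ℚ) ^ mo.e5 = u5
  -- only `ring` from here (`field_simp` takes two minutes on this goal): cancel the five `n_i · n_i⁻¹` by hand
  have hn : ∀ {n : ℚ}, n ≠ 0 → n * n⁻¹ = 1 := fun h => mul_inv_cancel₀ h
  calc _ = ↑Z.D * ((-1 : ℚ) ^ mo.d * ↑((Z.m + mo.d - 1).choose mo.d)) * ↑mo.mult * A * Q * (u1 * u2 * u3 * u4 * u5) / P *
        ((n1 * n1⁻¹) * (n2 * n2⁻¹) * (n3 * n3⁻¹) * (n4 * n4⁻¹) * (n5 * n5⁻¹)) := by ring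
    _ = _ := by rw [hn h1, hn h2, hn h3, hn h4, hn h5]; ring

/-- `list_sum_div` (docstring added by the landing lane; see the module docstring). [formal bookkeeping] -/
theorem list_sum_div (l : List ℚ) (D : ℚ) : l.sum / D = (l.map fun q => q / D).sum := by
  induction l with
  | nil => simp
  | cons a l ih => simp [add_div, ih]

/-- ★ The integer slot contribution IS the `ℚ` kernel's rounded contribution: `rcZ / D = rc`. -/
theorem CellZ.rcZ_cast (Z : CellZ) (hE : 0 < Z.E) (N : ℤ × ℤ × ℤ) (mo : Mono)
    (hmo : mo.e1 + mo.e2 + mo.e3 + mo.e4 + mo.e5 = mo.d) :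
    ((Z.rcZ N mo : ℤ) : ℚ) / Z.D = Z.toCell.rc N mo := by
  obtain ⟨x, y, z⟩ := N
  have hc := Z.toCell_cOf hE x y z
  have h9E : (0 : ℚ) < 9 * Z.E := by
    have : (0 : ℚ) < Z.E := by exact_mod_cast hE
    linarith
  by_cases hK : Z.K x y z ≤ 0
  · have hc0 : Z.toCell.cOf x y z ≤ 0 := by
      rw [hc]; exact div_nonpos_of_nonpos_of_nonneg (by exact_mod_cast hK) h9E.le
    simp [CellZ.rcZ, Cell.rc, hK, hc0]
  · rw [not_le] at hK
    have hc0 : ¬ Z.toCell.cOf x y z ≤ 0 := by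
      rw [hc, not_le]; exact div_pos (by exact_mod_cast hK) h9E
    have hK0 : ¬ Z.K x y z ≤ 0 := not_le.2 hK
    simp only [CellZ.rcZ, Cell.rc, hK0, hc0, if_false, CellZ.toCell_J, CellZ.toCell_D]
    by_cases hd : mo.d < Z.J
    · simp only [hd, if_true]
      unfold rdn
      rw [Z.termQ_mul_D hE x y z mo hmo hK]
      have hP : 0 < Z.K x y z ^ (Z.m + mo.d) := pow_pos hK _
      have hcast : ((Z.K x y z ^ (Z.m + mo.d) : ℤ) : ℚ) = (((Z.K x y z ^ (Z.m + mo.d)).toNat : ℕ) : ℚ) := by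
        rw [← Int.cast_natCast, Int.toNat_of_nonneg hP.le]
      rw [hcast, Rat.floor_intCast_div_natCast, Int.toNat_of_nonneg hP.le]
    · simp [hd]

/-- ★ The integer table, divided by `D`, IS the `ℚ` kernel's coefficient table. -/
theorem CellZ.coefZ_cast (Z : CellZ) (hE : 0 < Z.E) (vs : List (ℤ × ℤ × ℤ)) :
    (Z.coefZ vs).map (fun c : ℤ => (c : ℚ) / Z.D) = (Z.toCell.acc vs).coef := by
  rw [Z.coefZ_eq, Cell.acc_coef, List.map_map]
  apply List.map_congr_left
  intro mo hmo
  show (((vs.map fun N => Z.rcZ N mo).sum : ℤ) : ℚ) / Z.D = (vs.map fun N => Z.toCell.rc N mo).sum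
  rw [Int.cast_list_sum, List.map_map, list_sum_div, List.map_map]
  congr 1
  apply List.map_congr_left
  intro N _
  exact Z.rcZ_cast hE N mo (monos_d_sum mo hmo)

/-- `W` of a chunked family from INTEGER per-chunk tables. -/
theorem CertRow.W_of_chunksZ (R : CertRow) (Z : CellZ) (hZ : R.C.withM 3 = Z.toCell) (hE : 0 < Z.E)
    (L : List (List (ℤ × ℤ × ℤ))) (T : List (List ℤ)) (hT : L.map Z.coefZ = T)
    (r : ℚ) (hr : (R.acc3 L.flatten).rem = r) :
    R.W L.flatten = addConst (slotSum (T.map fun Ti => Ti.map fun c : ℤ => (c : ℚ) / Z.D))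
      (r + 126 * ((L.flatten.length : ℚ) / R.C.D) + R.F6hi) := by
  apply R.W_of_chunks L _ _ r hr
  rw [← hT, List.map_map]
  apply List.map_congr_left
  intro l _
  show ((R.C.withM 3).acc l).coef = (Z.coefZ l).map fun c : ℤ => (c : ℚ) / Z.D
  rw [hZ]
  exact (Z.coefZ_cast hE l).symm

/-- `V` of a chunked family from INTEGER per-chunk tables. -/
theorem CertRow.V_of_chunksZ (R : CertRow) (Z : CellZ) (hZ : R.C.withM 6 = Z.toCell) (hE : 0 < Z.E)
    (L : List (List (ℤ × ℤ × ℤ))) (T : List (List ℤ)) (hT : L.map Z.coefZ = T)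
    (r : ℚ) (hr : (R.acc6 L.flatten).rem = r) :
    R.V L.flatten = addConst (slotSum (T.map fun Ti => Ti.map fun c : ℤ => (c : ℚ) / Z.D))
      (R.F12lo - (r + 126 * ((L.flatten.length : ℚ) / R.C.D))) := by
  apply R.V_of_chunks L _ _ r hr
  rw [← hT, List.map_map]
  apply List.map_congr_left
  intro l _
  show ((R.C.withM 6).acc l).coef = (Z.coefZ l).map fun c : ℤ => (c : ℚ) / Z.D
  rw [hZ]
  exact (Z.coefZ_cast hE l).symm

end Summit.AtomisticToContinuum.Crystallization.Theorems.OverbindingBudgetAffineTaylorCell
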